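import Mathlib.LinearAlgebra.Matrix.SchurComplement
import Mathlib.LinearAlgebra.Matrix.NonsingularInverse
import Mathlib.LinearAlgebra.Dimension.Constructions
import Mathlib.Analysis.SpecialFunctions.Log.Basic
import Mathlib.Data.Fin.Tuple.Sort
import Literature.MathematicalPhysics.QuantumFieldTheory.GraphPeriod
import Literature.Analysis.TotalPositivity.MultiplyPositiveProofs
import HarnessLib

/-!
# The Hepp (power-counting) bound for the Kirchhoff determinant of a primitive-divergent graph

Topic `MathematicalPhysics/QuantumFieldTheory`; support file for the discharge of the named fact
`graphPeriod_convergent_of_isPrimitiveDivergent` of `GraphPeriod.lean` (the discharge itself is in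
`GraphPeriodProofs.lean`). Everything here is elementary linear algebra about the block determinant
`Ψ_E(y) = det [[diag y, ℰ], [-ℰᵀ, 0]]` (`kirchhoffEval`) of an edge list `E`:

* `kirchhoffEval_eq_prod_mul_det_gram` — Schur complement:
  `Ψ_E(y) = (Π_e y_e) · det(ℰᵀ diag(y⁻¹) ℰ)` for non-vanishing weights (Brown 2009, proof of
  Prop. 21);
* `det_gram_eq_sum` — Cauchy–Binet (the tree's
  `Literature.Analysis.TotalPositivity.det_mul_eq_sum_strictMono`):
  `det(ℰᵀ diag(w) ℰ) = Σ_t (Π_i w_{t i}) det(ℰ_t)²` over increasing `t : Fin V → Fin N`, i.e.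
  Brown's expansion `det M_G = Σ_I Π_{i∉I} α_i det(ℰ_G(I))²` (Prop. 21);
* `prod_compl_le_kirchhoffEval` — hence, for positive weights and any `V` rows `t` of `ℰ` with
  non-zero (integer!) determinant, `Π_{e ∉ t} y_e ≤ Ψ_E(y)` and `0 < Ψ_E(y)`;
* `exists_greedyRows` — the greedy (Kruskal) row basis of a family of vectors indexed by `Fin N`:
  the indices whose vector is not in the span of the earlier ones; it is linearly independent and
  its first-`j` part spans the same space as the first `j` vectors, so `#(T ∩ [0,j)) = rank` of the
  first `j` rows;
* `hepp_abel_ineq` — Abel summation: if the prefix sums of signs `c_i` are `≤ -1` and the total is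
  `0`, then `a_max - a_min ≤ Σ c_i a_i` for monotone `a`;
* (`GraphPeriodProofs.lean` then proves `heppBound`: for a connected primitive-divergent edge list
  and positive weights, `(Π_e y_e) · y_j ≤ Ψ_E(y)² · y_i` for all `i, j` — the affine shadow of the
  Hepp-sector estimate `Ψ ≥ Π_k t_k^{h(γ_k)}` — together with `0 < Ψ_E(y)`.)

No new definitions are introduced: the prefix `{k : Fin N | k < j}` of the first `j` indices is
written literally as `univ.filter fun k : Fin N => (k : ℕ) < j` throughout.

Sources: F. Brown, arXiv:0910.0114, §2.2 Lemma 20, Prop. 21, §3.1 [Brown2009FeynmanPeriods];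
S. Bloch, H. Esnault, D. Kreimer, CMP 267 (2006), Prop. 5.2 [BlochEsnaultKreimer2006]. The
power-counting argument (greedy spanning tree in each Hepp sector) is the folklore sector
decomposition (Hepp 1966, Speer 1975); BEK prove convergence instead by blowing up momentum-space
quadrics, which we do not follow.
-/

noncomputable section

open Matrix Finset

namespace Literature.MathematicalPhysics.QuantumFieldTheory

variable {N V : ℕ}

/-! ### Schur complement and Cauchy–Binet for the graph matrix -/

section Algebra

/-- The reduced incidence matrix has entries in `{0, ±1}`: it is the image of the integer one under
any ring homomorphism. [folklore] -/
theorem reducedIncidence_map {R S : Type*} [CommRing R] [CommRing S] (f : R →+* S)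
    (E : Fin N → Fin (V + 1) × Fin (V + 1)) :
    (reducedIncidence R E).map f = reducedIncidence S E := by
  ext e j
  simp [reducedIncidence, Matrix.map_apply, apply_ite f]

/-- **Schur complement form of the Kirchhoff determinant**: for non-vanishing edge weights,
`Ψ_E(y) = (Π_e y_e) · det (ℰᵀ · diag(y⁻¹) · ℰ)` (Brown 2009, proof of Prop. 21).
[cite: Brown2009FeynmanPeriods, Prop. 21 (proof)] -/
theorem kirchhoffEval_eq_prod_mul_det_gram {K : Type*} [Field K]
    (E : Fin N → Fin (V + 1) × Fin (V + 1)) (y : Fin N → K) (hy : ∀ e, y e ≠ 0) :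
    kirchhoffEval E y = (∏ e, y e) *
      ((reducedIncidence K E)ᵀ * diagonal (fun e => (y e)⁻¹) * reducedIncidence K E).det := by
  letI : Invertible (diagonal y) :=
    invertibleOfRightInverse _ (diagonal fun e => (y e)⁻¹) (by
      rw [diagonal_mul_diagonal, ← diagonal_one]
      congr 1
      funext e
      exact mul_inv_cancel₀ (hy e))
  rw [kirchhoffEval, graphMatrix, det_fromBlocks₁₁, det_diagonal]
  congr 1
  rw [Matrix.neg_mul, Matrix.neg_mul, zero_sub, neg_neg]
  rfl

open scoped Classical in
/-- **Cauchy–Binet expansion of the Gram determinant** `det (ℰᵀ diag(w) ℰ) = Σ_t (Π_i w (t i)) ·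
det(ℰ_t)²`, the sum over strictly increasing `t : Fin V → Fin N` (`ℰ_t` = the rows `t` of `ℰ`);
with `kirchhoffEval_eq_prod_mul_det_gram` this is Brown's `det M_G = Σ_I Π_{i∉I} α_i det(ℰ_G(I))²`.
[cite: Brown2009FeynmanPeriods, Prop. 21 (proof)] -/
theorem det_gram_eq_sum {K : Type*} [Field K] (E : Fin N → Fin (V + 1) × Fin (V + 1))
    (w : Fin N → K) :
    ((reducedIncidence K E)ᵀ * diagonal w * reducedIncidence K E).det =
      ∑ t ∈ (univ : Finset (Fin V → Fin N)).filter (fun t => StrictMono t),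
        (∏ i, w (t i)) * ((reducedIncidence K E).submatrix t id).det ^ 2 := by
  rw [Literature.Analysis.TotalPositivity.det_mul_eq_sum_strictMono]
  refine Finset.sum_congr rfl fun t _ => ?_
  have h : ((reducedIncidence K E)ᵀ * diagonal w).submatrix id t =
      (diagonal (w ∘ t) * (reducedIncidence K E).submatrix t id)ᵀ := by
    ext j i
    simp [Matrix.mul_diagonal, Matrix.diagonal_mul, mul_comm]
  rw [h, det_transpose, det_mul, det_diagonal]
  simp only [Function.comp_apply]
  ring

/-- **Lower bound by one spanning tree.** For positive edge weights `y` and any `V` rows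
`t : Fin V → Fin N` (increasing) of the integer incidence matrix with non-zero determinant,
`Π_{e ∉ im t} y_e ≤ Ψ_E(y)` and `0 < Ψ_E(y)`: all Cauchy–Binet terms are `≥ 0` and the `t`-term is
`(Π_i y_{t i}⁻¹) det(ℰ_t)²` with `det(ℰ_t)² ≥ 1` (a non-zero integer). [folklore] -/
theorem prod_compl_le_kirchhoffEval (E : Fin N → Fin (V + 1) × Fin (V + 1)) (y : Fin N → ℝ)
    (hy : ∀ e, 0 < y e) {t : Fin V → Fin N} (ht : StrictMono t)
    (hdet : ((reducedIncidence ℤ E).submatrix t id).det ≠ 0) :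
    ∏ e ∈ (univ.image t)ᶜ, y e ≤ kirchhoffEval E y ∧ 0 < kirchhoffEval E y := by
  classical
  set w : Fin N → ℝ := fun e => (y e)⁻¹ with hw
  set S : Finset (Fin V → Fin N) := univ.filter (fun s => StrictMono s) with hS
  set term : (Fin V → Fin N) → ℝ :=
    fun s => (∏ i, w (s i)) * ((reducedIncidence ℝ E).submatrix s id).det ^ 2 with hterm
  have hf : kirchhoffEval E y = (∏ e, y e) * ∑ s ∈ S, term s := by
    rw [kirchhoffEval_eq_prod_mul_det_gram E y (fun e => (hy e).ne'), det_gram_eq_sum]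
  have hterm0 : ∀ s ∈ S, 0 ≤ term s :=
    fun s _ => mul_nonneg (prod_nonneg fun i _ => (inv_pos.mpr (hy _)).le) (sq_nonneg _)
  have hdetR : (1 : ℝ) ≤ ((reducedIncidence ℝ E).submatrix t id).det ^ 2 := by
    have hmap : (reducedIncidence ℝ E).submatrix t id =
        (((reducedIncidence ℤ E).submatrix t id)).map (Int.castRingHom ℝ) := by
      rw [← Matrix.submatrix_map, reducedIncidence_map]
    rw [hmap, ← RingHom.mapMatrix_apply, ← RingHom.map_det, eq_intCast]
    have h1 : (1 : ℤ) ≤ ((reducedIncidence ℤ E).submatrix t id).det ^ 2 := by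
      have habs := Int.one_le_abs hdet
      nlinarith [sq_abs (((reducedIncidence ℤ E).submatrix t id).det), abs_nonneg
        (((reducedIncidence ℤ E).submatrix t id).det)]
    exact_mod_cast h1
  have hprod : 0 < ∏ e, y e := prod_pos fun e _ => hy e
  have hwt : 0 < ∏ i, w (t i) := prod_pos fun i _ => inv_pos.mpr (hy _)
  have htS : t ∈ S := by simp [hS, ht]
  have hsum : ∏ i, w (t i) ≤ ∑ s ∈ S, term s :=
    calc ∏ i, w (t i) ≤ term t := le_mul_of_one_le_right hwt.le hdetR
      _ ≤ ∑ s ∈ S, term s := Finset.single_le_sum hterm0 htS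
  refine ⟨?_, ?_⟩
  · have hsplit : ∏ e ∈ (univ.image t)ᶜ, y e = (∏ e, y e) * ∏ i, w (t i) := by
      rw [← Finset.prod_mul_prod_compl (univ.image t) y,
        Finset.prod_image fun i _ j _ h => ht.injective h]
      have hcancel : (∏ i, y (t i)) * ∏ i, w (t i) = 1 := by
        rw [← Finset.prod_mul_distrib]
        exact Finset.prod_eq_one fun i _ => mul_inv_cancel₀ (hy _).ne'
      calc ∏ e ∈ (univ.image t)ᶜ, y e = (∏ e ∈ (univ.image t)ᶜ, y e) * 1 := (mul_one _).symm
        _ = (∏ e ∈ (univ.image t)ᶜ, y e) * ((∏ i, y (t i)) * ∏ i, w (t i)) := by rw [hcancel]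
        _ = (∏ i, y (t i)) * (∏ e ∈ (univ.image t)ᶜ, y e) * ∏ i, w (t i) := by ring
    rw [hsplit, hf]
    exact mul_le_mul_of_nonneg_left hsum hprod.le
  · rw [hf]
    exact mul_pos hprod (hwt.trans_le hsum)

end Algebra

/-! ### Prefixes of `Fin N` and the greedy row basis -/

section Prefix

/-! The prefix of the first `j` indices is `univ.filter fun k : Fin N => (k : ℕ) < j` (`j : ℕ`,
`0 ≤ j ≤ N`; no definition is introduced for it). -/

/-- Membership in a prefix: an instance of Mathlib's `Finset.mem_filter_univ` (unused in the tree);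
deprecated restatement (dedup-01124, 2026-08-16). [folklore] -/
@[deprecated Finset.mem_filter_univ (since := "2026-08-16")]
theorem mem_ltFilter {j : ℕ} {i : Fin N} :
    i ∈ (univ.filter fun k : Fin N => (k : ℕ) < j) ↔ (i : ℕ) < j :=
  mem_filter_univ i

/-- Prefixes past the end are everything. [folklore] -/
theorem ltFilter_of_le {j : ℕ} (h : N ≤ j) :
    (univ.filter fun k : Fin N => (k : ℕ) < j) = univ := by
  ext i; simpa using lt_of_lt_of_le i.isLt h

/-- The successor prefix. [folklore] -/
theorem ltFilter_succ {j : ℕ} (h : j < N) :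
    (univ.filter fun k : Fin N => (k : ℕ) < j + 1) =
      insert ⟨j, h⟩ (univ.filter fun k : Fin N => (k : ℕ) < j) := by
  ext i
  simp only [Finset.mem_filter, Finset.mem_univ, true_and, Finset.mem_insert, Fin.ext_iff]
  omega

/-- The new index is not in the old prefix. [folklore] -/
theorem not_mem_ltFilter_self {j : ℕ} (h : j < N) :
    (⟨j, h⟩ : Fin N) ∉ (univ.filter fun k : Fin N => (k : ℕ) < j) := by simp

/-- The prefix of length `j ≤ N` has `j` elements. [folklore] -/
theorem card_ltFilter {j : ℕ} (h : j ≤ N) :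
    (univ.filter fun k : Fin N => (k : ℕ) < j).card = j := by
  induction j with
  | zero => simp
  | succ j ih =>
    rw [ltFilter_succ h, Finset.card_insert_of_notMem (not_mem_ltFilter_self h),
      ih (Nat.le_of_succ_le h)]

end Prefix

section Greedy

variable (K : Type*) {M : Type*} [Field K] [AddCommGroup M] [Module K M]

/-- **The greedy (Kruskal) row basis.** For a family `v : Fin N → M` over a field there is a set
`T` of indices — those `i` whose vector is not in the span of `v 0, …, v (i-1)` — which is linearly
independent and whose first-`j` part spans the same space as the first `j` vectors, for every `j`;
hence `#(T ∩ [0,j))` is the rank of the first `j` vectors. For the rows of an incidence matrix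
ordered by edge weight, `T` is the spanning tree of Kruskal's algorithm. [folklore] -/
theorem exists_greedyRows (v : Fin N → M) :
    ∃ T : Finset (Fin N), LinearIndepOn K v ↑T ∧
      ∀ j : ℕ, ((T ∩ (univ.filter fun k : Fin N => (k : ℕ) < j)).card : ℕ) =
        Module.finrank K (Submodule.span K (v '' ↑(univ.filter fun k : Fin N => (k : ℕ) < j))) := by
  classical
  set T : Finset (Fin N) := univ.filter fun i =>
    v i ∉ Submodule.span K (v '' ↑(univ.filter fun k : Fin N => (k : ℕ) < (i : ℕ))) with hT
  -- invariant: the greedy set restricted to each prefix spans it and is independent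
  have key : ∀ j : ℕ,
      Submodule.span K (v '' ↑(T ∩ univ.filter fun k : Fin N => (k : ℕ) < j)) =
          Submodule.span K (v '' ↑(univ.filter fun k : Fin N => (k : ℕ) < j)) ∧
        LinearIndepOn K v ↑(T ∩ univ.filter fun k : Fin N => (k : ℕ) < j) := by
    intro j
    induction j with
    | zero => simp
    | succ j ih =>
      by_cases hj : j < N
      · set i : Fin N := ⟨j, hj⟩ with hi
        rw [ltFilter_succ hj]
        by_cases hmem : v i ∈ Submodule.span K (v '' ↑(univ.filter fun k : Fin N => (k : ℕ) < j))
        · have hnot : i ∉ T := by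
            rw [hT, Finset.mem_filter]
            exact fun h => h.2 hmem
          rw [Finset.inter_insert_of_notMem hnot, Finset.coe_insert, Set.image_insert_eq,
            Submodule.span_insert_eq_span hmem]
          exact ih
        · have hin : i ∈ T := by
            rw [hT, Finset.mem_filter]
            exact ⟨Finset.mem_univ _, hmem⟩
          rw [Finset.inter_insert_of_mem hin, Finset.coe_insert, Finset.coe_insert,
            Set.image_insert_eq, Set.image_insert_eq, Submodule.span_insert, Submodule.span_insert,
            ih.1]
          refine ⟨rfl, ih.2.insert ?_⟩
          rw [ih.1]
          exact hmem
      · push Not at hj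
        rw [ltFilter_of_le (Nat.le_succ_of_le hj), ← ltFilter_of_le hj]
        exact ih
  refine ⟨T, ?_, fun j => ?_⟩
  · have := (key N).2
    rwa [ltFilter_of_le le_rfl, Finset.inter_univ] at this
  · obtain ⟨hspan, hli⟩ := key j
    rw [← hspan, Set.image_eq_range, finrank_span_eq_card hli.linearIndependent]
    simp only [Finset.coe_sort_coe, Fintype.card_coe]

end Greedy

/-! ### Abel summation -/

/-- **Abel summation inequality behind the Hepp bound.** If `a : Fin N → ℝ` is monotone and the
signs `c` have all proper prefix sums `≤ -1` and total sum `0`, then `a i₁ - a i₀ ≤ Σ_i c_i a_i`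
for all `i₀, i₁` (by induction on prefixes: `Σ_{i<m} c_i a_i ≥ a_{m-1} - a_0 + S_m a_{m-1}`).
[folklore] -/
theorem hepp_abel_ineq (a c : Fin N → ℝ) (hmono : Monotone a)
    (hS : ∀ m, 0 < m → m < N → ∑ i ∈ univ.filter (fun k : Fin N => (k : ℕ) < m), c i ≤ -1)
    (hSN : ∑ i, c i = 0) (i₀ i₁ : Fin N) : a i₁ - a i₀ ≤ ∑ i, c i * a i := by
  have hN : 0 < N := Fin.pos i₀
  have key : ∀ m (hm : 1 ≤ m) (hmN : m ≤ N),
      a ⟨m - 1, by omega⟩ - a ⟨0, hN⟩ +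
          (∑ i ∈ univ.filter (fun k : Fin N => (k : ℕ) < m), c i) * a ⟨m - 1, by omega⟩ ≤
        ∑ i ∈ univ.filter (fun k : Fin N => (k : ℕ) < m), c i * a i := by
    intro m hm hmN
    induction m with
    | zero => exact absurd hm (by omega)
    | succ m ih =>
      have hmN' : m < N := hmN
      rw [ltFilter_succ hmN', Finset.sum_insert (not_mem_ltFilter_self hmN'),
        Finset.sum_insert (not_mem_ltFilter_self hmN')]
      have hlast : (⟨m + 1 - 1, by omega⟩ : Fin N) = ⟨m, hmN'⟩ := Fin.ext (by simp)
      rw [hlast]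
      rcases Nat.eq_zero_or_pos m with rfl | hmpos
      · simp
      · have ih' := ih hmpos hmN'.le
        have hSm := hS m hmpos hmN'
        have hle : a ⟨m - 1, by omega⟩ ≤ a ⟨m, hmN'⟩ :=
          hmono (Fin.mk_le_mk.mpr (Nat.sub_le m 1))
        nlinarith [mul_nonneg_of_nonpos_of_nonpos
          (by linarith : (1 : ℝ) + ∑ i ∈ univ.filter (fun k : Fin N => (k : ℕ) < m), c i ≤ 0)
          (sub_nonpos.mpr hle), ih', hSm]
  have hfin := key N hN le_rfl
  rw [ltFilter_of_le le_rfl] at hfin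
  simp only [hSN, zero_mul, add_zero] at hfin
  have h1 : a i₁ ≤ a ⟨N - 1, by omega⟩ := hmono (Fin.mk_le_mk.mpr (by have := i₁.isLt; omega))
  have h0 : a ⟨0, hN⟩ ≤ a i₀ := hmono (Fin.mk_le_mk.mpr (Nat.zero_le _))
  linarith

end Literature.MathematicalPhysics.QuantumFieldTheory
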